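import Summits.ResolutionOfSingularities.ResolutionOfSingularities.Theorems.HomologicalConductorNoZenoGWH2ResolutionDelta
import Literature.AlgebraicGeometry.Resolution.BlowupSerreVanishingLocal
import Literature.AlgebraicGeometry.Morphisms.CechCocycleCoherentSubmodule
import HarnessLib

/-!
# Crux `NoZenoR` (stmt-ResolutionOfSingularities-19943) — DR-F53 (δ): the door instance `GWH2ResolutionDim2` HOLDS

OURS (cell res-hironaka, crux chain W4.4; route (δ) «domination + divisorial twist», booked by director-resolution g7
2026-08-28T09:12:49Z, route lead res-inputs-p-9b, with res-inputs-p-9c (S2, S6a, S6-local), res-inputs-p-5b (S8), res-inputs-p-9a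
((c′)), and the earlier (a′)(b′)(d′)). Counted 0; AI-written, weaker than expert review; nothing here is a statement of the manuscript
under review (Hironaka 2017).

`NoZeno.GWH2ResolutionDim2` (`HomologicalConductorNoZenoGWH2Instance.lean` §R3b; V35 ledger conjunct 6 of the W4.4 line): for `A` a
Noetherian local domain of Krull dimension `2`, `π : X → Spec A` a resolution (`X` integral, locally Noetherian), `M` affine-localizing
and `𝒰` a finite affine open cover, `Ȟ²(𝒰, M) = 0`.  PROVED here, fact-free, by one application of the reduction of record
`gwH2ResolutionDim2_of_localVanishing_of_cocycleExtension'` (`…GWH2ResolutionDelta.lean`, over the Literature theorem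
`Morphisms.subsingleton_cechMH2_of_isResolution_of_localVanishing_of_cocycleExtension`) to the two tree theorems
* `Literature.AlgebraicGeometry.Resolution.exists_affine_family_cechMZ1_idealMul_pow_le_of_torsionFree`
  (`Resolution/BlowupSerreVanishingLocal.lean`: local Serre vanishing `H¹(r⁻¹U, 𝓙ⁿG) = 0` on blow-up charts) and
* `Literature.AlgebraicGeometry.Morphisms.exists_coh_cechMZ2_map_eq` (`Morphisms/CechCocycleCoherentSubmodule.lean`: a Čech
  `2`-cocycle of a quasi-coherent module on a finite affine cover of a separated Noetherian scheme lies in a coherent submodule).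
Inside the Literature theorem: Stacks 081T domination by a blow-up of `Spec A` (`Morphisms/NagataCompactificationProofs`,
`Resolution/ResolutionDominatedByBlowup`), the divisorial / codimension-two split of its centre on the regular surface
(`Resolution/DivisorialPart`, Auslander–Buchsbaum), `Ȟ² = 0` on the projective dominating blow-up (`Morphisms/CechH2FibreDimOneProjective`,
Görtz–Wedhorn II Cor. 24.44 projective case), the torsion-free `𝓙ⁿ`-twist (`Morphisms/TorsionFreeIdealPowerTwist`) and the degree-two
Čech transfers (`Morphisms/CechModuleH2TwoCover(s)`, `…CoverIndependence`, `…IsoTransfer`, `…MorphismTransfer`) — NO theorem on formal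
functions and NO Lipman (27.2).

* `gwH2ResolutionDim2_holds : GWH2ResolutionDim2`.
* `GWH2ResolutionDim2.cechMapH1_surjective_holds` — re-export (i) at resolutions, now hypothesis-free.

Scope / honesty: this makes the REGULAR-`X` resolution instance a theorem; the instance `GWH2ProperBirationalDim2` (Y merely integral)
and the general named fact `Literature.AlgebraicGeometry.Morphisms.GortzWedhorn2023_24_44_H2` STAY PRINT / untouched; the typed fact
`Lipman1969_27_2_regular` is not used; the V35 ledger's conjunct 6 is discharged only when the W4.4 desk's by-name
`example : NoZeno.GWH2ResolutionDim2 := NoZeno.gwH2ResolutionDim2_holds` is rc 0 (director term (3)).  No summit statement is proved;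
resolution of singularities in dimension ≥ 4 / characteristic p is NOT proved by anything here.
-/

-- single-problem summit: the doubled namespace component `ResolutionOfSingularities` is forced
set_option linter.dupNamespace false

open CategoryTheory CategoryTheory.Limits AlgebraicGeometry TopologicalSpace
open Literature.AlgebraicGeometry.Morphisms Literature.AlgebraicGeometry.Resolution
open Literature.AlgebraicGeometry.Modules

namespace Summit.ResolutionOfSingularities.ResolutionOfSingularities.Theorems.NoZeno

/-- **`GWH2ResolutionDim2` HOLDS** (route (δ)): `Ȟ²(𝒰, M) = 0` for every affine-localizing `M` and every finite affine open cover of a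
resolution of the spectrum of a two-dimensional Noetherian local domain — the reduction `gwH2ResolutionDim2_of_localVanishing_of_cocycleExtension'`
applied to the tree theorems `Resolution.exists_affine_family_cechMZ1_idealMul_pow_le_of_torsionFree` (local Serre vanishing on blow-up
charts) and `Morphisms.exists_coh_cechMZ2_map_eq` (coherent submodule of a Čech cocycle). [this work] -/
theorem gwH2ResolutionDim2_holds : GWH2ResolutionDim2 :=
  gwH2ResolutionDim2_of_localVanishing_of_cocycleExtension'
    (fun _A _ _ _X _ _ _S' _ _ fS r J hr U hU G hG htf =>
      Literature.AlgebraicGeometry.Resolution.exists_affine_family_cechMZ1_idealMul_pow_le_of_torsionFree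
        fS r J hr U hU G hG htf)
    (fun _X _ _ _A _ f _ι _ U hU _M hM z hz =>
      Literature.AlgebraicGeometry.Morphisms.exists_coh_cechMZ2_map_eq f U hU hM z hz)

/-- **Re-export (i) at resolutions, hypothesis-free**: `Ȟ¹` is right exact on a resolution of the spectrum of a Noetherian local domain of
dimension `2` — for `0 → M′ → M → M″ → 0` with `M′` affine-localizing and any finite affine open cover `𝒰`,
`Ȟ¹(𝒰, M) → Ȟ¹(𝒰, M″)` is surjective (`GWH2ResolutionDim2.cechMapH1_surjective` fed with `gwH2ResolutionDim2_holds`). [this work] -/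
theorem GWH2ResolutionDim2.cechMapH1_surjective_holds
    {A : Type} [CommRing A] [IsNoetherianRing A] [IsLocalRing A] [IsDomain A] (hA : ringKrullDim A = 2)
    {X : Scheme.{0}} [IsIntegral X] [IsLocallyNoetherian X] (π : X ⟶ Spec (.of A)) (hπ : IsResolution π)
    {ι : Type} [Finite ι] (U : ι → X.Opens)
    {S : ShortComplex X.Modules} (hS : S.ShortExact) (h₁ : IsAffineLocalizing S.X₁)
    (hU : ∀ i, IsAffineOpen (U i)) (hcov : ⨆ i, U i = ⊤) :
    Function.Surjective (cechMapH1 π S.g U) :=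
  GWH2ResolutionDim2.cechMapH1_surjective gwH2ResolutionDim2_holds π U hA hπ hS h₁ hU hcov

end Summit.ResolutionOfSingularities.ResolutionOfSingularities.Theorems.NoZeno
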